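import Mathlib
import HarnessLib
import Summits.HubbardSuperconductivity.HubbardSuperconductivity.Theorems.KLProgrammeKLRegimeCountertermJacksonRemainderCertAnDefs
import Summits.HubbardSuperconductivity.HubbardSuperconductivity.Theorems.KLProgrammeKLRegimeCountertermJacksonTransportMoment
import Summits.HubbardSuperconductivity.HubbardSuperconductivity.Theorems.KLProgrammeKLRegimeCountertermJacksonKernelTailSharp
import Summits.HubbardSuperconductivity.HubbardSuperconductivity.Theorems.KLProgrammeKLRegimeCountertermJacksonRemainderScaleLaw

/-!
# (C1) ANALYTIC CERTIFICATE at deep scales, part 7 — the SCALE LAWS of the analytic table at the flow degree `d = klFlowDeg n = 2⁷·4ⁿ`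

Cell `gate-hubbard-kl`, seat hubbard-kl-k3c3-p3 (g12), `--supports stmt-HubbardSuperconductivity-20437` (stub (C) of `KLRegimeEngineV17F2`),
located item «(C1)-DEEP-AN».  The analytic certificate table `klC1TableAn (klFlowDeg n) (31/2500) 1.8289 1.688 D` (…CertAnDefs; the instance of
…CertAnFrame / …CertAnKlEng with near half-width `δ₀ = 31/2500`, `4δ₀ + 10⁻⁹ ≤ klFlatR`) has entries = (near slope)·`π√3/(d+1)` + (far constant)·`farMass`
and the transport row `π√3/(2(d+1)(ulo − 2δ₀)) + π·farMass`.  Here, for the (C) closer's budget (p578720's term laws read `X/(d+1)^p`):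
* `klC1FarMass (klFlowDeg n) (31/2500) ≤ 1.514·(1/64)ⁿ` (`farMass_klFlowDeg_le`; `(16/π)(24/23)⁴ < 6.05`, `π³ < 31.01`);
* `π√3/(klFlowDeg n + 1) ≤ 0.04252·(1/4)ⁿ` (`nearMoment_klFlowDeg_le`);
* **THE TRANSPORT ROW IS `n`-FREE IN THE RIGHT UNITS**: `Td ≤ 0.01179·(1/4)ⁿ + π·1.514·(1/64)ⁿ` (`klC1TableAn_Td_le`) — the `κ = 0.0118` of the rate
  rows `a_{k+1}·Td` against `bar(k, n+1) = 4^{k−2}·bar(k, n)` (C1-JETBOX-DEEP §0(b): shares `κ·(c_{k+1}/c_k)/4^{k−2}`);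
* every other entry: `N0 ≤ 1.514·64⁻ⁿ`, `N i ≤ c_i·1.514·64⁻ⁿ`, `Mc k i l ≤ c_i·P_{k−i,l}(Xfar)·1.514·64⁻ⁿ`,
  `Tt k l ≤ Tn_{kl}·0.04252·4⁻ⁿ + P_{kl}(Xfar)·1.514·64⁻ⁿ`, `Tu k ≤ kΛ₁(1+2δ₀Λ₁)ᵏ·0.04252·4⁻ⁿ + (Xfar₁ᵏ + 1)·1.514·64⁻ⁿ` (`klC1TableAn_rows_le`) —
  with the near/far constants still carrying the (possibly growing) curve jets `D 3, D 4` of the flow frame LINEARLY, as `jacksonScale_frame_term_law` wants;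
* the no-rate top row is k3c3-p1's `boundNR` `2·a_k` by definition (share `2/16` at `k = 4`).
Numbers [exact arithmetic on the closed forms]: with the registered table-shaped history `klC4aJetC` the (C1) shares of the next bar are
`(2.9·10⁻⁴, 0.200, 0.502, 0.133)` at reading scale 6 and `(≤ 1.1·10⁻⁴, 0.189, 0.377, 0.125)` from scale 7 on (`k = 1, 2, 3` rate, `k = 4` no-rate;
script `HOME/hubbard-kl-k3c3-p3/g12/table_an.py`).  Arithmetic only; nothing here asserts stub (C) or superconductivity.
-/

noncomputable section

namespace Summit.HubbardSuperconductivity.HubbardSuperconductivity.Theorems.KLRegimeSplit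

set_option linter.dupNamespace false -- summit = problem name (single-conjunct summit), D-0017

open Real

/-! ## §1 The two kernel quantities at the flow degree -/

/-- `π√3 < 5.4415`. -/
theorem pi_mul_sqrt_three_lt : π * Real.sqrt 3 < 5.4415 := by
  have hπ : π < 3.1416 := Real.pi_lt_d4
  have h3 : Real.sqrt 3 < 1.73206 := by rw [Real.sqrt_lt' (by norm_num)]; norm_num
  have h0 : 0 < Real.sqrt 3 := Real.sqrt_pos.mpr (by norm_num)
  nlinarith [Real.pi_pos]

/-- **Near moment at the flow degree**: `π√3/(klFlowDeg n + 1) ≤ 0.04252·(1/4)ⁿ`. -/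
theorem nearMoment_klFlowDeg_le (n : ℕ) : π * Real.sqrt 3 / (((klFlowDeg n : ℕ) : ℝ) + 1) ≤ 0.04252 * (1 / 4 : ℝ) ^ n := by
  rw [klFlowDeg_cast]
  have h4 : (0 : ℝ) < 4 ^ n := by positivity
  have hnum : 0 ≤ π * Real.sqrt 3 := by positivity
  have hlt := pi_mul_sqrt_three_lt
  calc π * Real.sqrt 3 / ((2 : ℝ) ^ 7 * 4 ^ n + 1) ≤ π * Real.sqrt 3 / ((2 : ℝ) ^ 7 * 4 ^ n) :=
        div_le_div_of_nonneg_left hnum (by positivity) (by linarith)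
    _ = (π * Real.sqrt 3 / 2 ^ 7) * (1 / 4 : ℝ) ^ n := by rw [one_div_pow]; field_simp
    _ ≤ 0.04252 * (1 / 4 : ℝ) ^ n := by
        apply mul_le_mul_of_nonneg_right _ (by positivity)
        rw [div_le_iff₀ (by norm_num)]; nlinarith

/-- `π³ < 31.01`. -/
theorem pi_pow_three_lt : π ^ 3 < 31.01 := by
  have hπ : π < 3.1416 := Real.pi_lt_d4
  have h0 := Real.pi_pos
  nlinarith [mul_pos h0 h0]

/-- **Far mass at the flow degree** (`δ₀ = 31/2500`): `klC1FarMass (klFlowDeg n) (31/2500) ≤ 1.514·(1/64)ⁿ`. -/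
theorem farMass_klFlowDeg_le (n : ℕ) : klC1FarMass (klFlowDeg n) (31 / 2500) ≤ 1.514 * (1 / 64 : ℝ) ^ n := by
  unfold klC1FarMass
  rw [klFlowDeg_cast]
  have h4 : (0 : ℝ) < 4 ^ n := by positivity
  have hd : (2 : ℝ) ^ 7 * 4 ^ n ≤ (2 : ℝ) ^ 7 * 4 ^ n + 1 := by linarith
  have hA := sixteen_div_pi_mul_pow_lt
  have hB := pi_pow_three_lt
  have hA0 : 0 ≤ 16 / π * (24 / 23 : ℝ) ^ 4 := by positivity
  have e64 : (1 / 64 : ℝ) ^ n = 1 / (4 ^ n) ^ 3 := by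
    rw [one_div_pow, ← pow_mul, show (64 : ℝ) = 4 ^ 3 by norm_num, ← pow_mul, mul_comm]
  -- each summand against the clean power
  have h1 : 16 / π * (24 / 23 : ℝ) ^ 4 / (((2 : ℝ) ^ 7 * 4 ^ n + 1) * (31 / 2500)) ^ 3 ≤ 6.05 / ((2 : ℝ) ^ 7 * 4 ^ n * (31 / 2500)) ^ 3 := by
    have hden : ((2 : ℝ) ^ 7 * 4 ^ n * (31 / 2500)) ^ 3 ≤ (((2 : ℝ) ^ 7 * 4 ^ n + 1) * (31 / 2500)) ^ 3 := by
      apply pow_le_pow_left₀ (by positivity); nlinarith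
    calc _ ≤ 16 / π * (24 / 23 : ℝ) ^ 4 / ((2 : ℝ) ^ 7 * 4 ^ n * (31 / 2500)) ^ 3 :=
          div_le_div_of_nonneg_left hA0 (by positivity) hden
      _ ≤ 6.05 / ((2 : ℝ) ^ 7 * 4 ^ n * (31 / 2500)) ^ 3 := div_le_div_of_nonneg_right hA.le (by positivity)
  have h2 : π ^ 3 / ((2 : ℝ) ^ 7 * 4 ^ n + 1) ^ 3 ≤ 31.01 / ((2 : ℝ) ^ 7 * 4 ^ n) ^ 3 := by
    have hden : ((2 : ℝ) ^ 7 * 4 ^ n) ^ 3 ≤ ((2 : ℝ) ^ 7 * 4 ^ n + 1) ^ 3 := pow_le_pow_left₀ (by positivity) hd 3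
    calc _ ≤ π ^ 3 / ((2 : ℝ) ^ 7 * 4 ^ n) ^ 3 := div_le_div_of_nonneg_left (by positivity) (by positivity) hden
      _ ≤ 31.01 / ((2 : ℝ) ^ 7 * 4 ^ n) ^ 3 := div_le_div_of_nonneg_right hB.le (by positivity)
  have e : (6.05 : ℝ) / ((2 : ℝ) ^ 7 * 4 ^ n * (31 / 2500)) ^ 3 + 31.01 / ((2 : ℝ) ^ 7 * 4 ^ n) ^ 3 =
      (6.05 / ((2 : ℝ) ^ 7 * (31 / 2500)) ^ 3 + 31.01 / ((2 : ℝ) ^ 7) ^ 3) * (1 / (4 ^ n) ^ 3) := by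
    field_simp
  have hc : (6.05 : ℝ) / ((2 : ℝ) ^ 7 * (31 / 2500)) ^ 3 + 31.01 / ((2 : ℝ) ^ 7) ^ 3 ≤ 1.514 := by norm_num
  calc _ ≤ (6.05 : ℝ) / ((2 : ℝ) ^ 7 * 4 ^ n * (31 / 2500)) ^ 3 + 31.01 / ((2 : ℝ) ^ 7 * 4 ^ n) ^ 3 := add_le_add h1 h2
    _ = (6.05 / ((2 : ℝ) ^ 7 * (31 / 2500)) ^ 3 + 31.01 / ((2 : ℝ) ^ 7) ^ 3) * (1 / (4 ^ n) ^ 3) := e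
    _ ≤ 1.514 * (1 / 64 : ℝ) ^ n := by rw [e64]; exact mul_le_mul_of_nonneg_right hc (by positivity)

/-! ## §2 The rows of the analytic table at the flow degree -/

section Rows

variable (n : ℕ) (D : ℕ → ℝ)

/-- **THE TRANSPORT ROW, `n`-FREE IN THE RIGHT UNITS**: `Td(klFlowDeg n) ≤ 0.01179·(1/4)ⁿ + π·1.514·(1/64)ⁿ` (radius floor `1.8289 − 2δ₀`). -/
theorem klC1TableAn_Td_le :
    (klC1TableAn (klFlowDeg n) (31 / 2500) 1.8289 1.688 D).Td ≤ 0.01179 * (1 / 4 : ℝ) ^ n + π * (1.514 * (1 / 64 : ℝ) ^ n) := by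
  show π * Real.sqrt 3 / (2 * (((klFlowDeg n : ℕ) : ℝ) + 1)) / (1.8289 - 2 * (31 / 2500)) + π * klC1FarMass (klFlowDeg n) (31 / 2500) ≤ _
  have h1 := transport_sigma_klFlowDeg_le n
  have hlt := pi_mul_sqrt_three_lt
  have hq : (0 : ℝ) < (1 / 4 : ℝ) ^ n := by positivity
  have hT : π * Real.sqrt 3 / (2 * (((klFlowDeg n : ℕ) : ℝ) + 1)) / (1.8289 - 2 * (31 / 2500)) ≤ 0.01179 * (1 / 4 : ℝ) ^ n := by
    rw [div_le_iff₀ (by norm_num)]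
    refine h1.trans ?_
    rw [show (0.01179 : ℝ) * (1 / 4 : ℝ) ^ n * (1.8289 - 2 * (31 / 2500)) = (0.01179 * (1.8289 - 2 * (31 / 2500))) * (1 / 4 : ℝ) ^ n by ring]
    apply mul_le_mul_of_nonneg_right _ hq.le
    rw [div_le_iff₀ (by norm_num)]; nlinarith
  have hF := mul_le_mul_of_nonneg_left (farMass_klFlowDeg_le n) Real.pi_pos.le
  linarith

/-- **THE OTHER ROWS at the flow degree** (near slope × `0.04252·4⁻ⁿ` + far constant × `1.514·64⁻ⁿ`), for nonnegative near/far constants: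
`N0`, `N i`, `Mc k i l`, `Tt k l`, `Tu k` of `klC1TableAn (klFlowDeg n) (31/2500) 1.8289 1.688 D`. -/
theorem klC1TableAn_rows_le (hD : ∀ i, 0 ≤ D i) :
    let T := klC1TableAn (klFlowDeg n) (31 / 2500) 1.8289 1.688 D
    T.N0 ≤ 1.514 * (1 / 64 : ℝ) ^ n ∧
    (∀ i, T.N i ≤ klC1AnCut D i * (1.514 * (1 / 64 : ℝ) ^ n)) ∧
    (∀ k i l, T.Mc k i l ≤ klC1AnCut D i * bellP (k - i) l (klC1AnXfar D 1.688) * (1.514 * (1 / 64 : ℝ) ^ n)) ∧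
    (∀ k l, T.Tt k l ≤ klC1AnTn D (1.8289 - 2 * (31 / 2500)) (31 / 2500) k l * (0.04252 * (1 / 4 : ℝ) ^ n) +
      bellP k l (klC1AnXfar D 1.688) * (1.514 * (1 / 64 : ℝ) ^ n)) ∧
    (∀ k : ℕ, T.Tu k ≤ k * klC1AnLam D (1.8289 - 2 * (31 / 2500)) 1 * (1 + 2 * (31 / 2500) * klC1AnLam D (1.8289 - 2 * (31 / 2500)) 1) ^ k *
      (0.04252 * (1 / 4 : ℝ) ^ n) + (klC1AnXfar D 1.688 1 ^ k + 1) * (1.514 * (1 / 64 : ℝ) ^ n)) := by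
  intro T
  have hFM := farMass_klFlowDeg_le n
  have hm := nearMoment_klFlowDeg_le n
  have d1 := hD 1; have d2 := hD 2; have d3 := hD 3; have d4 := hD 4
  have hρ : (0 : ℝ) < 1.8289 - 2 * (31 / 2500) := by norm_num
  have hLam : ∀ m, 0 ≤ klC1AnLam D (1.8289 - 2 * (31 / 2500)) m := fun m => by
    unfold klC1AnLam; split_ifs <;> positivity
  have hXf : ∀ m, 0 ≤ klC1AnXfar D 1.688 m := fun m => by unfold klC1AnXfar; split_ifs <;> positivity
  have hc : ∀ i, 0 ≤ klC1AnCut D i := fun i => by unfold klC1AnCut; split_ifs <;> positivity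
  have hTn : ∀ k l, 0 ≤ klC1AnTn D (1.8289 - 2 * (31 / 2500)) (31 / 2500) k l := fun k l => by
    have l1 := hLam 1; have l2 := hLam 2; have l3 := hLam 3; have l4 := hLam 4
    unfold klC1AnTn; split_ifs <;> positivity
  have hb : ∀ j l, 0 ≤ bellP j l (klC1AnXfar D 1.688) := bellP_nonneg hXf
  refine ⟨hFM, fun i => ?_, fun k i l => ?_, fun k l => ?_, fun k => ?_⟩
  · exact mul_le_mul_of_nonneg_left hFM (hc i)
  · exact mul_le_mul_of_nonneg_left hFM (mul_nonneg (hc i) (hb _ _))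
  · exact add_le_add (mul_le_mul_of_nonneg_left hm (hTn k l)) (mul_le_mul_of_nonneg_left hFM (hb k l))
  · refine add_le_add (mul_le_mul_of_nonneg_left hm ?_) (mul_le_mul_of_nonneg_left hFM ?_)
    · have := hLam 1; positivity
    · have := hXf 1; positivity

end Rows

end Summit.HubbardSuperconductivity.HubbardSuperconductivity.Theorems.KLRegimeSplit

end
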